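import Summits.QuantumFields.YangMills.Theorems.BalabanUVNodesN19RekeyingAbsorptionClassForm
import Literature.MathematicalPhysics.QuantumFieldTheory.Balaban1983to89.T4BadClassBooking

/-!
# BalabanUVNodes ∕ node N19 (NE7) — THE BILL FLAG: flag the classes by their OWN likelihood-ratio bill; N20's face for the flagged classes PRODUCED from a MEAN-bill letter
# (Markov) or an exponential-moment letter (Chernoff); p613310's class form with NO uniform modulus; the threshold as a DIAL and the square-root rule (sufficient, and necessary
# for the Markov road); the loud-COUNT instance (g4 `modulus_le_of_loudCount` inhabited with N20's face produced, not assumed)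

Cell `pub-ymgap` (HUMAN RULING D-0062 Track A ∕ D-0149 width seats), WIDTH SEAT `pub-ymgap-dag-n19-w1` (node n19 = NE7, seat 1 of 3), generation g5, CLAIM-1 ∕ INTENT-1.  Route
`Summits/QuantumFields/YangMills/Theses/BalabanUVNodes.lean`, key item K3⁷ `SpineGivenEndpointR13SepCoPH` (stmt-QuantumFields-20544; v5 941dddb108cbaacf stub 2 `stub_expansion13H`,
conjuncts N19′ `KeyedCoreEdgeHolderD4` ∧ N20 `KeyedRelWeight`); filed `--kind proof --supports … --as helper`.  COUNT-NEUTRAL.  THEOREMS ONLY (0 `def`, 0 `sorry`).  ADDITIVE —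
imports this seat's g4 `…Theorems.BalabanUVNodesN19RekeyingAbsorptionClassForm` (p613310∕p618673: `modulus_le_of_loudCount`; through it p610409 `chain_lower ∕ chain_upper`, dag-n19-e's
`…N19CoreMetric.core_of_subset`, the tree's `Spine/NE7/Targets` (`Core`), `T4MatchingAssembly` (`HybridNE7`, `hybridNE7_noShell`), `T4WeightBudget` (`RelWeightBound`)) and the tree's
`T4BadClassBooking` (`relWeightBound_union`) ONLY; modifies nothing.

WHY.  p613310's complete law-merge binder list «(Y) young matching + (D) one-run factorisation on the good classes + NE7b on the flagged ones» carries TWO free slots: the flag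
`Bad` and N20's weight `W` for it, and ONE class-uniform letter: the LR moduli bounded on the good classes, `s_A ≤ S_A(K)`, `s_B ≤ S_B(K)`.  Its §2 remark `modulus_le_of_loudCount`
(«flag by COUNT of loud blocks») names the natural flag but leaves N20's face for it ASSUMED.  THIS FILE closes the loop inside the calculus: flag the classes BY THEIR OWN BILL —
`Bad K t := {τ ∈ T K | S_K < s_A + s_B}` — so that on the kept classes the modulus letter holds BY DEFINITION, and PRODUCE N20's face for the flagged classes from the weakest
letter that can pay a tail: the FIRST MOMENT of the bill (Markov), or an exponential moment (Chernoff).  The threshold `S_K` becomes a DIAL trading the `Core` radius `S_K∕vol`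
against the N20 weight `μ_K∕S_K`, with an exact answer to «when does some dial work».
* §1 [folklore] ★ `threshold_mul_sum_filter_le` (MARKOV on a finite weighted sum: `S·Σ_{S<φ} a ≤ Σ φ·a`) · `sum_filter_le_of_meanLetter` (`Σ φ·a ≤ μ·Σ a ⇒ Σ_{S<φ} a ≤ (μ∕S)·Σ a`) ·
  ★ `exp_mul_sum_filter_le` (CHERNOFF: `e^{θS}·Σ_{S<φ} a ≤ Σ e^{θφ}·a`) · `sum_filter_le_of_expMomentLetter`.
* §2 [folklore] ★★ `relWeightBound_flag_of_meanLetters` — N20's face `RelWeightBound l₀ T A B {S < φ} (μ∕S)` for ANY non-negative class statistic `φ` from the two runs' MEAN letters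
  `Σ_τ φ·A ≤ μ_K·Σ_τ A`, `Σ_τ φ·B ≤ μ_K·Σ_τ B` (+ `μ∕S < 1` summable) — first moment only: what LINEARITY over per-term absolute letters delivers, no independence, no large deviation ·
  ★ `relWeightBound_flag_of_expMomentLetters` (weight `M_K e^{−θ_K S_K}`; the geometric twin of dag-n20-w2's per-VALUE letters at the record, `…N20KeyedRelWeightValueStrata`, which this
  file neither uses nor restates — theirs is an ℕ-valued statistic at dag-n20-d's carriers, this is the abstract carrier).
* §3 [folklore] ★ `core_of_classFactorisation_jointBill` (p613310's class form with the JOINT bound `s_A + s_B ≤ S_K`, radius `r + S∕vol`) · ★★★ `core_billFlag` (prior flag `Bad` +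
  bill flag on top: `Core … (Bad ∪ {S < s_A+s_B}) A B (r + S∕vol)` with NO modulus hypothesis) · ★★★ `hybridNE7_billFlag_of_meanBill` (THE COMPLETE BINDER LIST, N20 PRODUCED:
  factorisation shape + (Y) + mean-bill letters + dial ⇒ `HybridNE7 … {S < s_A+s_B} (μ∕S) 0 0 0 (r + S∕vol)`) · ★★ `hybridNE7_billFlag_of_meanBill_union` (on top of a prior flag of
  weight `W₀`: `(Bad ∪ …) (W₀ + μ∕S)` — where «pending OLD regions» go).
* §4 [folklore] `two_mul_sqrt_le_dial` (AM–GM: `μ∕S + S∕vol ≥ 2√(μ∕vol)` for every dial) · `sqrtDial_eq` (at `S = √(μ·vol)` weight = radius = `√(μ∕vol)`) ·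
  ★★ `exists_markovDial_iff` — a dial with BOTH `Σ μ_K∕S_K < ∞` and `Σ S_K∕vol < ∞` EXISTS IFF `Σ_K √(μ_K∕vol) < ∞`; in particular NO Markov dial under STEP-UNIFORM letters
  (`μ_K ≥ μ > 0`).
* §5 [folklore] ★★ `hybridNE7_countFlag_of_meanCount` (bill `≤ base_K + cnt·σl_K` ⇒ flag by COUNT `{ν < cnt}`, pay by the MEAN COUNT: `HybridNE7 … {ν < cnt} (μ∕ν) 0 0 0
  (r + (base + ν·σl)∕vol)`) · `blockBill_le_base_add_count_mul` (g4 `modulus_le_of_loudCount` BY NAME with `N :=` the class's own loud count: the blockwise bill IS a count bill).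
READINGS (located; nothing proposed).  (i) The uniform modulus of the (D) letter is not needed: a MEAN-modulus letter + the canonical bill flag give the complete binder list at the
price of a square root (`√(μ_K∕vol)` in place of `μ_K∕vol`), and for the Markov road that square-root condition is also necessary.  (ii) A mean COUNT is exactly what linearity
over per-cube ABSOLUTE letters ([LF-II] (1.89)-type) would give — but such one-run letters at a fixed window are STEP-UNIFORM in `K`, and §4 says no dial then exists: the bill
that can be summable is a two-run RELATIVE one (p613310 §3 `core_cross_of_core`, p618673 `coreEdge_iff_coreEdge_cross`), decaying in `K` like dag-n20-w3's two-run increments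
`θ^{K−m}` (p606497) — whose worst-class window budget the bill flag refines to a MEAN-class budget.  (iii) Nothing here is Bałaban's; whether any mean-bill letter holds for the
d = 4 densities is unprinted and unproved.

HONEST FRAMING.  Finite-sum ∕ elementary real-series bookkeeping [folklore] (Markov ∕ Chernoff on finite weighted sums, AM–GM) over the tree's SHAPES (`Core`, `RelWeightBound`,
`HybridNE7`); factorisations, moduli, statistics, mean letters occur as HYPOTHESES only; nothing of Bałaban's is asserted or instantiated; no estimate of the programme is proved.
NE7 ∕ NE7b NOT PRINTED as two-run statements for d = 4 ∕ NOT proved; N19 ∕ N20 NOT discharged; K3⁷ OPEN, not claimed, v5 untouched; counts UNMOVED (typed 28∕28 · discharged 5∕27,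
A 5∕28).  Everything below is PROVED (0 `sorry`, 0 named facts, standard axioms); no decl carries a cite tag.  One finite four-torus programme at fixed ε — NOT ℝ⁴, NOT infinite
volume, NOT OS, NOT a mass gap, NOT the Clay problem (R4 closes the conditional finite-𝕋⁴ rung `BalabanLadder.UV` only).
-/

noncomputable section

open Finset
open scoped BigOperators

namespace Summit.QuantumFields.YangMills.BalabanUVNodes.N19BillFlag

open Summit.QuantumFields.BalabanUV.T4Continuum.Spine.NE7 (Core)
open Literature.MathematicalPhysics.QuantumFieldTheory.Balaban1983to89
open T4WeightBudget (RelWeightBound)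
open T4BadClassBooking (relWeightBound_union)
open T4MatchingAssembly (HybridNE7 hybridNE7_noShell)
open Summit.QuantumFields.YangMills.BalabanUVNodes.N19CoreMetric (core_of_subset)
open Summit.QuantumFields.YangMills.BalabanUVNodes.N19RekeyingAbsorption (chain_lower chain_upper)
open Summit.QuantumFields.YangMills.BalabanUVNodes.N19RekeyingAbsorptionClassForm (modulus_le_of_loudCount)

/-! ## §1 Markov and Chernoff on a finite weighted sum [folklore] -/

section Tail
variable {ι : Type*} {T : Finset ι} {a φ : ι → ℝ} {S μ M θ : ℝ}

/-- **MARKOV ON A FINITE WEIGHTED SUM** [folklore]: for weights `a ≥ 0` and a statistic `φ ≥ 0` on `T`, `S · Σ_{τ ∈ T, S < φ τ} a τ ≤ Σ_{τ ∈ T} φ τ · a τ`. -/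
theorem threshold_mul_sum_filter_le (ha : ∀ τ ∈ T, 0 ≤ a τ) (hφ : ∀ τ ∈ T, 0 ≤ φ τ) :
    S * ∑ τ ∈ T.filter (fun τ => S < φ τ), a τ ≤ ∑ τ ∈ T, φ τ * a τ := by
  calc S * ∑ τ ∈ T.filter (fun τ => S < φ τ), a τ = ∑ τ ∈ T.filter (fun τ => S < φ τ), S * a τ := Finset.mul_sum _ _ _
    _ ≤ ∑ τ ∈ T.filter (fun τ => S < φ τ), φ τ * a τ := Finset.sum_le_sum fun τ hτ => by
        obtain ⟨hT, hS⟩ := Finset.mem_filter.mp hτ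
        exact mul_le_mul_of_nonneg_right hS.le (ha τ hT)
    _ ≤ ∑ τ ∈ T, φ τ * a τ :=
        Finset.sum_le_sum_of_subset_of_nonneg (Finset.filter_subset _ _) fun τ hT _ => mul_nonneg (hφ τ hT) (ha τ hT)

/-- **THE MEAN LETTER PRICES THE TAIL** [folklore]: `Σ_T φ·a ≤ μ·Σ_T a` (the `a`-mean of `φ` is at most `μ`) and `0 < S` ⇒ `Σ_{S < φ} a ≤ (μ∕S)·Σ_T a`. -/
theorem sum_filter_le_of_meanLetter (ha : ∀ τ ∈ T, 0 ≤ a τ) (hφ : ∀ τ ∈ T, 0 ≤ φ τ) (hS : 0 < S)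
    (hμ : ∑ τ ∈ T, φ τ * a τ ≤ μ * ∑ τ ∈ T, a τ) :
    ∑ τ ∈ T.filter (fun τ => S < φ τ), a τ ≤ μ / S * ∑ τ ∈ T, a τ := by
  have h := (threshold_mul_sum_filter_le (S := S) ha hφ).trans hμ
  rw [div_mul_eq_mul_div, le_div_iff₀ hS]
  linarith

/-- **CHERNOFF ON A FINITE WEIGHTED SUM** [folklore]: for `a ≥ 0` and `θ ≥ 0`, `e^{θS} · Σ_{τ ∈ T, S < φ τ} a τ ≤ Σ_{τ ∈ T} e^{θ·φ τ} · a τ`. -/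
theorem exp_mul_sum_filter_le (ha : ∀ τ ∈ T, 0 ≤ a τ) (hθ : 0 ≤ θ) :
    Real.exp (θ * S) * ∑ τ ∈ T.filter (fun τ => S < φ τ), a τ ≤ ∑ τ ∈ T, Real.exp (θ * φ τ) * a τ := by
  calc Real.exp (θ * S) * ∑ τ ∈ T.filter (fun τ => S < φ τ), a τ
      = ∑ τ ∈ T.filter (fun τ => S < φ τ), Real.exp (θ * S) * a τ := Finset.mul_sum _ _ _
    _ ≤ ∑ τ ∈ T.filter (fun τ => S < φ τ), Real.exp (θ * φ τ) * a τ := Finset.sum_le_sum fun τ hτ => by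
        obtain ⟨hT, hS⟩ := Finset.mem_filter.mp hτ
        exact mul_le_mul_of_nonneg_right (Real.exp_le_exp.mpr (mul_le_mul_of_nonneg_left hS.le hθ)) (ha τ hT)
    _ ≤ ∑ τ ∈ T, Real.exp (θ * φ τ) * a τ :=
        Finset.sum_le_sum_of_subset_of_nonneg (Finset.filter_subset _ _) fun τ hT _ => mul_nonneg (Real.exp_pos _).le (ha τ hT)

/-- **THE EXPONENTIAL-MOMENT LETTER PRICES THE TAIL GEOMETRICALLY** [folklore]: `Σ_T e^{θφ}·a ≤ M·Σ_T a` with `θ ≥ 0` ⇒ `Σ_{S < φ} a ≤ M·e^{−θS}·Σ_T a`. -/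
theorem sum_filter_le_of_expMomentLetter (ha : ∀ τ ∈ T, 0 ≤ a τ) (hθ : 0 ≤ θ)
    (hM : ∑ τ ∈ T, Real.exp (θ * φ τ) * a τ ≤ M * ∑ τ ∈ T, a τ) :
    ∑ τ ∈ T.filter (fun τ => S < φ τ), a τ ≤ M * Real.exp (-(θ * S)) * ∑ τ ∈ T, a τ := by
  have h := (exp_mul_sum_filter_le (S := S) (φ := φ) ha hθ).trans hM
  calc ∑ τ ∈ T.filter (fun τ => S < φ τ), a τ
      = Real.exp (-(θ * S)) * (Real.exp (θ * S) * ∑ τ ∈ T.filter (fun τ => S < φ τ), a τ) := by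
        rw [← mul_assoc, ← Real.exp_add, neg_add_cancel, Real.exp_zero, one_mul]
    _ ≤ Real.exp (-(θ * S)) * (M * ∑ τ ∈ T, a τ) := mul_le_mul_of_nonneg_left h (Real.exp_pos _).le
    _ = M * Real.exp (-(θ * S)) * ∑ τ ∈ T, a τ := by ring

end Tail

/-! ## §2 N20's face for a threshold flag, PRODUCED from mean letters ∕ exponential-moment letters [folklore] -/

section Face
variable {ι : Type*} {l₀ : ℝ} {T : ℕ → Finset ι} {A B φ : ℕ → ℝ → ι → ℝ} {S μ M θ : ℕ → ℝ}

/-- **★★ N20's FACE FOR A THRESHOLD FLAG FROM THE MEAN LETTERS (Markov)** [folklore].  Flag at level `K`, source `t`, the classes whose statistic exceeds the threshold,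
`Bad K t := {τ ∈ T K | S_K < φ K t τ}` (`φ ≥ 0`, `S_K > 0`).  If in BOTH runs the class-weight mean of `φ` is at most `μ_K` (`Σ_τ φ·A ≤ μ_K·Σ_τ A`, `Σ_τ φ·B ≤ μ_K·Σ_τ B` on
`|t| ≤ l₀`), `0 ≤ μ_K`, `μ_K∕S_K < 1` and `Σ_K μ_K∕S_K < ∞`, then `RelWeightBound l₀ T A B Bad (μ∕S)`.  Only the FIRST MOMENT is consumed (linearity over per-term letters; no
independence, no large deviation); the tail is polynomial in the threshold. -/
theorem relWeightBound_flag_of_meanLetters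
    (hA0 : ∀ (K : ℕ) (t : ℝ), |t| ≤ l₀ → ∀ τ ∈ T K, 0 ≤ A K t τ) (hB0 : ∀ (K : ℕ) (t : ℝ), |t| ≤ l₀ → ∀ τ ∈ T K, 0 ≤ B K t τ)
    (hφ : ∀ (K : ℕ) (t : ℝ), |t| ≤ l₀ → ∀ τ ∈ T K, 0 ≤ φ K t τ)
    (hμA : ∀ (K : ℕ) (t : ℝ), |t| ≤ l₀ → ∑ τ ∈ T K, φ K t τ * A K t τ ≤ μ K * ∑ τ ∈ T K, A K t τ)
    (hμB : ∀ (K : ℕ) (t : ℝ), |t| ≤ l₀ → ∑ τ ∈ T K, φ K t τ * B K t τ ≤ μ K * ∑ τ ∈ T K, B K t τ)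
    (hS : ∀ K, 0 < S K) (hμ0 : ∀ K, 0 ≤ μ K) (hlt : ∀ K, μ K / S K < 1) (hsum : Summable fun K => μ K / S K) :
    RelWeightBound l₀ T A B (fun K t => (T K).filter fun τ => S K < φ K t τ) (fun K => μ K / S K) where
  bad_subset _ _ _ := Finset.filter_subset _ _
  nonneg K := div_nonneg (hμ0 K) (hS K).le
  lt_one := hlt
  summable := hsum
  bad_left K t ht := sum_filter_le_of_meanLetter (hA0 K t ht) (hφ K t ht) (hS K) (hμA K t ht)
  bad_right K t ht := sum_filter_le_of_meanLetter (hB0 K t ht) (hφ K t ht) (hS K) (hμB K t ht)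

/-- **★ N20's FACE FOR A THRESHOLD FLAG FROM EXPONENTIAL-MOMENT LETTERS (Chernoff)** [folklore]: `Σ_τ e^{θ_K φ}·A ≤ M_K·Σ_τ A` and the same for `B` (`θ_K ≥ 0`, `M_K ≥ 0`),
`M_K e^{−θ_K S_K} < 1` summable ⇒ `RelWeightBound l₀ T A B {S < φ} (K ↦ M_K e^{−θ_K S_K})` — the geometric twin (cf. dag-n20-w2's per-value geometric letters at the record,
`…N20KeyedRelWeightValueStrata`, which it neither uses nor restates). -/
theorem relWeightBound_flag_of_expMomentLetters
    (hA0 : ∀ (K : ℕ) (t : ℝ), |t| ≤ l₀ → ∀ τ ∈ T K, 0 ≤ A K t τ) (hB0 : ∀ (K : ℕ) (t : ℝ), |t| ≤ l₀ → ∀ τ ∈ T K, 0 ≤ B K t τ)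
    (hθ : ∀ K, 0 ≤ θ K) (hM0 : ∀ K, 0 ≤ M K)
    (hMA : ∀ (K : ℕ) (t : ℝ), |t| ≤ l₀ → ∑ τ ∈ T K, Real.exp (θ K * φ K t τ) * A K t τ ≤ M K * ∑ τ ∈ T K, A K t τ)
    (hMB : ∀ (K : ℕ) (t : ℝ), |t| ≤ l₀ → ∑ τ ∈ T K, Real.exp (θ K * φ K t τ) * B K t τ ≤ M K * ∑ τ ∈ T K, B K t τ)
    (hlt : ∀ K, M K * Real.exp (-(θ K * S K)) < 1) (hsum : Summable fun K => M K * Real.exp (-(θ K * S K))) :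
    RelWeightBound l₀ T A B (fun K t => (T K).filter fun τ => S K < φ K t τ) (fun K => M K * Real.exp (-(θ K * S K))) where
  bad_subset _ _ _ := Finset.filter_subset _ _
  nonneg K := mul_nonneg (hM0 K) (Real.exp_pos _).le
  lt_one := hlt
  summable := hsum
  bad_left K t ht := sum_filter_le_of_expMomentLetter (hA0 K t ht) (hθ K) (hMA K t ht)
  bad_right K t ht := sum_filter_le_of_expMomentLetter (hB0 K t ht) (hθ K) (hMB K t ht)

end Face

/-! ## §3 The class form with a joint bill, the BILL FLAG (no modulus hypothesis), and the complete binder list [folklore] -/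

section ClassForm
variable {ι : Type*} [DecidableEq ι] {l₀ vol : ℝ} {T : ℕ → Finset ι} {Bad : ℕ → ℝ → Finset ι}
  {A B mA mB sA sB : ℕ → ℝ → ι → ℝ} {RA RB S r μ W₀ : ℕ → ℝ}

/-- **★ THE CLASS FORM WITH A JOINT BILL** [folklore] (p613310 `core_of_classFactorisation` with the two runs' moduli bounded JOINTLY): on every good class
`A ∈ e^{±s_A}·m_A·R_A`, `B ∈ e^{±s_B}·m_B·R_B` with `s_A + s_B ≤ S_K` there, `m_A ≥ 0`, `R_A, R_B > 0`, and `Core … Bad m_A m_B r` ⇒ `Core … Bad A B (r + S∕vol)`. -/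
theorem core_of_classFactorisation_jointBill (hvol : 0 < vol)
    (hA : ∀ (K : ℕ) (t : ℝ), |t| ≤ l₀ → ∀ τ ∈ T K \ Bad K t,
      Real.exp (-sA K t τ) * (mA K t τ * RA K) ≤ A K t τ ∧ A K t τ ≤ Real.exp (sA K t τ) * (mA K t τ * RA K))
    (hB : ∀ (K : ℕ) (t : ℝ), |t| ≤ l₀ → ∀ τ ∈ T K \ Bad K t,
      Real.exp (-sB K t τ) * (mB K t τ * RB K) ≤ B K t τ ∧ B K t τ ≤ Real.exp (sB K t τ) * (mB K t τ * RB K))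
    (hS : ∀ (K : ℕ) (t : ℝ), |t| ≤ l₀ → ∀ τ ∈ T K \ Bad K t, sA K t τ + sB K t τ ≤ S K)
    (hmA : ∀ (K : ℕ) (t : ℝ), |t| ≤ l₀ → ∀ τ ∈ T K \ Bad K t, 0 ≤ mA K t τ)
    (hRA : ∀ K, 0 < RA K) (hRB : ∀ K, 0 < RB K) (hm : Core l₀ vol T Bad mA mB r) :
    Core l₀ vol T Bad A B (fun K => r K + S K / vol) := by
  intro K
  obtain ⟨c₁, hc₁⟩ := hm K
  set C : ℝ := Real.log (RB K / RA K) with hC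
  have hCexp : Real.exp C * RA K = RB K := by
    rw [hC, Real.exp_log (div_pos (hRB K) (hRA K)), div_mul_cancel₀ _ (hRA K).ne']
  refine ⟨c₁ + C, fun t ht τ hτ => ?_⟩
  obtain ⟨hA₁, hA₂⟩ := hA K t ht τ hτ
  obtain ⟨hB₁, hB₂⟩ := hB K t ht τ hτ
  obtain ⟨hm₁, hm₂⟩ := hc₁ t ht τ hτ
  have hs := hS K t ht τ hτ
  have hmA0 := hmA K t ht τ hτ
  have hA0 : 0 ≤ A K t τ := (mul_nonneg (Real.exp_pos _).le (mul_nonneg hmA0 (hRA K).le)).trans hA₁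
  have hsum : vol * (S K / vol) = S K := mul_div_cancel₀ _ hvol.ne'
  constructor
  · have h := chain_lower hmA0 (hRB K).le hA₂ hB₁ hm₁ hCexp.le
    calc Real.exp (c₁ + C - vol * (r K + S K / vol)) * A K t τ
        ≤ Real.exp (-sB K t τ + (c₁ - vol * r K) + C - sA K t τ) * A K t τ :=
          mul_le_mul_of_nonneg_right (Real.exp_le_exp.mpr (by rw [mul_add, hsum]; linarith)) hA0
      _ ≤ B K t τ := h
  · have h := chain_upper hmA0 (hRB K).le hA₁ hB₂ hm₂ hCexp.ge
    calc B K t τ ≤ Real.exp (sB K t τ + (c₁ + vol * r K) + C + sA K t τ) * A K t τ := h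
      _ ≤ Real.exp (c₁ + C + vol * (r K + S K / vol)) * A K t τ :=
          mul_le_mul_of_nonneg_right (Real.exp_le_exp.mpr (by rw [mul_add, hsum]; linarith)) hA0

/-- The kept classes of the bill flag on top of a prior flag: `τ ∈ T K ∖ (Bad K t ∪ {S_K < φ})` iff `τ ∈ T K ∖ Bad K t` and `φ K t τ ≤ S_K`. [folklore] -/
theorem mem_sdiff_union_flag_iff {φ : ℕ → ℝ → ι → ℝ} {K : ℕ} {t : ℝ} {τ : ι} :
    τ ∈ T K \ (Bad K t ∪ (T K).filter fun τ => S K < φ K t τ) ↔ τ ∈ T K \ Bad K t ∧ φ K t τ ≤ S K := by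
  simp only [Finset.mem_sdiff, Finset.mem_union, Finset.mem_filter, not_or, not_and, not_lt]
  exact ⟨fun ⟨hT, hB, hle⟩ => ⟨⟨hT, hB⟩, hle hT⟩, fun ⟨⟨hT, hB⟩, hle⟩ => ⟨hT, hB, fun _ => hle⟩⟩

/-- **★★★ THE BILL FLAG** [folklore].  Factorisation letters with NON-NEGATIVE moduli on the classes kept by a prior flag `Bad` (`A ∈ e^{±s_A}·m_A·R_A`, `B ∈ e^{±s_B}·m_B·R_B`,
`m_A ≥ 0`, `R_A, R_B > 0`), young class factors matched there (`Core … Bad m_A m_B r`), and ANY threshold `S_K`: flag, on top of `Bad`, the classes whose own bill is large,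
`{τ | S_K < s_A + s_B}`.  Then `Core … (Bad ∪ {S < s_A+s_B}) A B (r + S∕vol)` — NO modulus hypothesis: on the kept classes the bill is `≤ S_K` by the flag's definition.  What is
left to pay is N20's face for the flagged classes (§2: a mean-bill letter suffices). -/
theorem core_billFlag (hvol : 0 < vol)
    (hA : ∀ (K : ℕ) (t : ℝ), |t| ≤ l₀ → ∀ τ ∈ T K \ Bad K t,
      Real.exp (-sA K t τ) * (mA K t τ * RA K) ≤ A K t τ ∧ A K t τ ≤ Real.exp (sA K t τ) * (mA K t τ * RA K))
    (hB : ∀ (K : ℕ) (t : ℝ), |t| ≤ l₀ → ∀ τ ∈ T K \ Bad K t,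
      Real.exp (-sB K t τ) * (mB K t τ * RB K) ≤ B K t τ ∧ B K t τ ≤ Real.exp (sB K t τ) * (mB K t τ * RB K))
    (hmA : ∀ (K : ℕ) (t : ℝ), |t| ≤ l₀ → ∀ τ ∈ T K \ Bad K t, 0 ≤ mA K t τ)
    (hRA : ∀ K, 0 < RA K) (hRB : ∀ K, 0 < RB K) (hm : Core l₀ vol T Bad mA mB r) :
    Core l₀ vol T (fun K t => Bad K t ∪ (T K).filter fun τ => S K < sA K t τ + sB K t τ) A B (fun K => r K + S K / vol) := by
  have hsub : ∀ (K : ℕ) (t : ℝ), |t| ≤ l₀ →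
      T K \ (Bad K t ∪ (T K).filter fun τ => S K < sA K t τ + sB K t τ) ⊆ T K \ Bad K t :=
    fun K t _ => Finset.sdiff_subset_sdiff (Finset.Subset.refl _) Finset.subset_union_left
  refine core_of_classFactorisation_jointBill hvol (fun K t ht τ hτ => hA K t ht τ (hsub K t ht hτ))
    (fun K t ht τ hτ => hB K t ht τ (hsub K t ht hτ)) (fun K t ht τ hτ => ?_) (fun K t ht τ hτ => hmA K t ht τ (hsub K t ht hτ)) hRA hRB
    (core_of_subset le_rfl hsub hm)
  exact ((mem_sdiff_union_flag_iff (φ := fun K t τ => sA K t τ + sB K t τ)).mp hτ).2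

/-- The kept classes of the bill flag alone: `τ ∈ T K ∖ {S_K < φ}` iff `τ ∈ T K` and `φ K t τ ≤ S_K`. [folklore] -/
theorem mem_sdiff_flag_iff {φ : ℕ → ℝ → ι → ℝ} {K : ℕ} {t : ℝ} {τ : ι} :
    τ ∈ T K \ (T K).filter (fun τ => S K < φ K t τ) ↔ τ ∈ T K ∧ φ K t τ ≤ S K := by
  simp only [Finset.mem_sdiff, Finset.mem_filter, not_and, not_lt]
  exact ⟨fun ⟨hT, hle⟩ => ⟨hT, hle hT⟩, fun ⟨hT, hle⟩ => ⟨hT, fun _ => hle⟩⟩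

/-- **★★★ THE COMPLETE BINDER LIST WITH THE BILL FLAG, N20 PRODUCED FROM THE MEAN BILL** [folklore].  Factorisation letters with non-negative moduli on ALL classes
(`A ∈ e^{±s_A}·m_A·R_A`, `B ∈ e^{±s_B}·m_B·R_B`, `m_A ≥ 0`, `R_A, R_B > 0`), young class factors matched on all classes at a summable radius `r` (`Core … ∅ m_A m_B r`), non-negative
class weights, the MEAN-BILL letters `Σ_τ (s_A+s_B)·A ≤ μ_K·Σ_τ A` and `Σ_τ (s_A+s_B)·B ≤ μ_K·Σ_τ B` (`μ_K ≥ 0`), and a threshold dial `S_K > 0` with `μ_K∕S_K < 1`, `Σ_K μ_K∕S_K < ∞`,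
`Σ_K (r_K + S_K∕vol) < ∞` ⇒ `HybridNE7 l₀ vol T A B {S < s_A+s_B} (μ∕S) 0 0 0 (r + S∕vol)`.  Reading: «(Y) young matching + the one-run factorisation SHAPE + a FIRST-MOMENT letter on
the LR bill» — NO class-uniform modulus is asked: p613310's `S_A + S_B` is replaced by the mean `μ` and a dial, the flag is canonical, and N20's face is PRODUCED (Markov). -/
theorem hybridNE7_billFlag_of_meanBill (hvol : 0 < vol)
    (hA : ∀ (K : ℕ) (t : ℝ), |t| ≤ l₀ → ∀ τ ∈ T K,
      Real.exp (-sA K t τ) * (mA K t τ * RA K) ≤ A K t τ ∧ A K t τ ≤ Real.exp (sA K t τ) * (mA K t τ * RA K))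
    (hB : ∀ (K : ℕ) (t : ℝ), |t| ≤ l₀ → ∀ τ ∈ T K,
      Real.exp (-sB K t τ) * (mB K t τ * RB K) ≤ B K t τ ∧ B K t τ ≤ Real.exp (sB K t τ) * (mB K t τ * RB K))
    (hmA : ∀ (K : ℕ) (t : ℝ), |t| ≤ l₀ → ∀ τ ∈ T K, 0 ≤ mA K t τ)
    (hRA : ∀ K, 0 < RA K) (hRB : ∀ K, 0 < RB K) (hm : Core l₀ vol T (fun _ _ => ∅) mA mB r)
    (hA0 : ∀ (K : ℕ) (t : ℝ), |t| ≤ l₀ → ∀ τ ∈ T K, 0 ≤ A K t τ) (hB0 : ∀ (K : ℕ) (t : ℝ), |t| ≤ l₀ → ∀ τ ∈ T K, 0 ≤ B K t τ)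
    (hs0 : ∀ (K : ℕ) (t : ℝ), |t| ≤ l₀ → ∀ τ ∈ T K, 0 ≤ sA K t τ + sB K t τ)
    (hμA : ∀ (K : ℕ) (t : ℝ), |t| ≤ l₀ → ∑ τ ∈ T K, (sA K t τ + sB K t τ) * A K t τ ≤ μ K * ∑ τ ∈ T K, A K t τ)
    (hμB : ∀ (K : ℕ) (t : ℝ), |t| ≤ l₀ → ∑ τ ∈ T K, (sA K t τ + sB K t τ) * B K t τ ≤ μ K * ∑ τ ∈ T K, B K t τ)
    (hS : ∀ K, 0 < S K) (hμ0 : ∀ K, 0 ≤ μ K) (hlt : ∀ K, μ K / S K < 1) (hμS : Summable fun K => μ K / S K)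
    (hrad : Summable fun K => r K + S K / vol) :
    HybridNE7 l₀ vol T A B (fun K t => (T K).filter fun τ => S K < sA K t τ + sB K t τ) (fun K => μ K / S K)
      (fun _ _ _ => 0) (fun _ _ _ => 0) (fun _ => 0) (fun K => r K + S K / vol) := by
  have hW := relWeightBound_flag_of_meanLetters (φ := fun K t τ => sA K t τ + sB K t τ) hA0 hB0 hs0 hμA hμB hS hμ0 hlt hμS
  have hsub : ∀ (K : ℕ) (t : ℝ), |t| ≤ l₀ → T K \ (T K).filter (fun τ => S K < sA K t τ + sB K t τ) ⊆ T K \ ∅ :=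
    fun K t _ => Finset.sdiff_subset_sdiff (Finset.Subset.refl _) (Finset.empty_subset _)
  refine hybridNE7_noShell hW hA0 hB0 hrad
    (core_of_classFactorisation_jointBill hvol (fun K t ht τ hτ => hA K t ht τ (Finset.mem_sdiff.mp hτ).1)
      (fun K t ht τ hτ => hB K t ht τ (Finset.mem_sdiff.mp hτ).1) (fun K t ht τ hτ => ?_) (fun K t ht τ hτ => hmA K t ht τ (Finset.mem_sdiff.mp hτ).1)
      hRA hRB (core_of_subset le_rfl hsub hm))
  exact ((mem_sdiff_flag_iff (φ := fun K t τ => sA K t τ + sB K t τ)).mp hτ).2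

/-- **★★ … ON TOP OF A PRIOR FLAG** [folklore]: the same with the letters asked only on the classes kept by a prior flag `Bad` carrying its own N20 weight `W₀`
(`RelWeightBound … Bad W₀`; the mean-bill letters still over all of `T K`, the moduli extended by anything non-negative), `W₀ + μ∕S < 1` ⇒
`HybridNE7 … (Bad ∪ {S < s_A+s_B}) (W₀ + μ∕S) 0 0 0 (r + S∕vol)` (`T4BadClassBooking.relWeightBound_union` BY NAME).  The prior flag is where «pending OLD regions» go. -/
theorem hybridNE7_billFlag_of_meanBill_union (hvol : 0 < vol)
    (hA : ∀ (K : ℕ) (t : ℝ), |t| ≤ l₀ → ∀ τ ∈ T K \ Bad K t,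
      Real.exp (-sA K t τ) * (mA K t τ * RA K) ≤ A K t τ ∧ A K t τ ≤ Real.exp (sA K t τ) * (mA K t τ * RA K))
    (hB : ∀ (K : ℕ) (t : ℝ), |t| ≤ l₀ → ∀ τ ∈ T K \ Bad K t,
      Real.exp (-sB K t τ) * (mB K t τ * RB K) ≤ B K t τ ∧ B K t τ ≤ Real.exp (sB K t τ) * (mB K t τ * RB K))
    (hmA : ∀ (K : ℕ) (t : ℝ), |t| ≤ l₀ → ∀ τ ∈ T K \ Bad K t, 0 ≤ mA K t τ)
    (hRA : ∀ K, 0 < RA K) (hRB : ∀ K, 0 < RB K) (hm : Core l₀ vol T Bad mA mB r) (hW₀ : RelWeightBound l₀ T A B Bad W₀)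
    (hA0 : ∀ (K : ℕ) (t : ℝ), |t| ≤ l₀ → ∀ τ ∈ T K, 0 ≤ A K t τ) (hB0 : ∀ (K : ℕ) (t : ℝ), |t| ≤ l₀ → ∀ τ ∈ T K, 0 ≤ B K t τ)
    (hs0 : ∀ (K : ℕ) (t : ℝ), |t| ≤ l₀ → ∀ τ ∈ T K, 0 ≤ sA K t τ + sB K t τ)
    (hμA : ∀ (K : ℕ) (t : ℝ), |t| ≤ l₀ → ∑ τ ∈ T K, (sA K t τ + sB K t τ) * A K t τ ≤ μ K * ∑ τ ∈ T K, A K t τ)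
    (hμB : ∀ (K : ℕ) (t : ℝ), |t| ≤ l₀ → ∑ τ ∈ T K, (sA K t τ + sB K t τ) * B K t τ ≤ μ K * ∑ τ ∈ T K, B K t τ)
    (hS : ∀ K, 0 < S K) (hμ0 : ∀ K, 0 ≤ μ K) (hlt : ∀ K, W₀ K + μ K / S K < 1) (hμS : Summable fun K => μ K / S K)
    (hrad : Summable fun K => r K + S K / vol) :
    HybridNE7 l₀ vol T A B (fun K t => Bad K t ∪ (T K).filter fun τ => S K < sA K t τ + sB K t τ) (W₀ + fun K => μ K / S K)
      (fun _ _ _ => 0) (fun _ _ _ => 0) (fun _ => 0) (fun K => r K + S K / vol) := by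
  have hlt' : ∀ K, μ K / S K < 1 := fun K => by linarith [hlt K, hW₀.nonneg K]
  have hW := relWeightBound_union hW₀
    (relWeightBound_flag_of_meanLetters (φ := fun K t τ => sA K t τ + sB K t τ) hA0 hB0 hs0 hμA hμB hS hμ0 hlt' hμS) hlt hA0 hB0
  exact hybridNE7_noShell hW hA0 hB0 hrad (core_billFlag hvol hA hB hmA hRA hRB hm)

end ClassForm

/-! ## §4 The threshold as a dial: the square-root rule [folklore] -/

section Dial
variable {vol : ℝ} {μ S : ℕ → ℝ}

/-- **AM–GM FOR THE MARKOV DIAL** [folklore]: whatever the threshold `S > 0`, weight plus radius `μ∕S + S∕vol ≥ 2·√(μ∕vol)` (`μ ≥ 0`, `vol > 0`). -/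
theorem two_mul_sqrt_le_dial {μ S vol : ℝ} (hμ : 0 ≤ μ) (hS : 0 < S) (hvol : 0 < vol) :
    2 * Real.sqrt (μ / vol) ≤ μ / S + S / vol := by
  have hx : 0 ≤ μ / S := div_nonneg hμ hS.le
  have hy : 0 ≤ S / vol := div_nonneg hS.le hvol.le
  have hprod : μ / S * (S / vol) = μ / vol := by
    rw [div_mul_div_comm, mul_comm μ (S), mul_div_mul_left μ vol hS.ne']
  rw [← hprod, Real.sqrt_mul hx]
  nlinarith [sq_nonneg (Real.sqrt (μ / S) - Real.sqrt (S / vol)), Real.sq_sqrt hx, Real.sq_sqrt hy,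
    Real.sqrt_nonneg (μ / S), Real.sqrt_nonneg (S / vol)]

/-- **THE SQUARE-ROOT DIAL** [folklore]: at `S := √(μ·vol)` (`μ > 0`, `vol > 0`) weight and radius are both `√(μ∕vol)`: `μ∕√(μ·vol) = √(μ∕vol)` and `√(μ·vol)∕vol = √(μ∕vol)`. -/
theorem sqrtDial_eq {μ vol : ℝ} (hμ : 0 < μ) (hvol : 0 < vol) :
    μ / Real.sqrt (μ * vol) = Real.sqrt (μ / vol) ∧ Real.sqrt (μ * vol) / vol = Real.sqrt (μ / vol) := by
  have h1 : Real.sqrt (μ * vol) = Real.sqrt μ * Real.sqrt vol := Real.sqrt_mul hμ.le vol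
  have h2 : Real.sqrt (μ / vol) = Real.sqrt μ / Real.sqrt vol := Real.sqrt_div hμ.le vol
  have hsv : 0 < Real.sqrt vol := Real.sqrt_pos.mpr hvol
  constructor
  · rw [h1, h2, div_mul_eq_div_div, Real.div_sqrt]
  · rw [h1, h2, div_eq_div_iff hvol.ne' hsv.ne', mul_assoc, Real.mul_self_sqrt hvol.le]

/-- **★★ THE MARKOV ROAD EXISTS IFF THE SQUARE-ROOT CONDITION** [folklore].  For `μ ≥ 0`, `vol > 0`: there is a threshold dial `S_K > 0` with BOTH `Σ_K μ_K∕S_K < ∞` (the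
Markov weight summable) and `Σ_K S_K∕vol < ∞` (the bill radius summable) if and only if `Σ_K √(μ_K∕vol) < ∞`.  (⇐: `S_K := √(μ_K·vol) + 2^{−K}`; ⇒: AM–GM.)  In particular under
STEP-UNIFORM letters (`μ_K ≥ μ > 0` for all `K`) NO Markov dial exists. -/
theorem exists_markovDial_iff (hμ : ∀ K, 0 ≤ μ K) (hvol : 0 < vol) :
    (∃ S : ℕ → ℝ, (∀ K, 0 < S K) ∧ Summable (fun K => μ K / S K) ∧ Summable (fun K => S K / vol)) ↔
      Summable fun K => Real.sqrt (μ K / vol) := by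
  constructor
  · rintro ⟨S, hS, hw, hr⟩
    refine Summable.of_nonneg_of_le (fun K => Real.sqrt_nonneg _) (fun K => ?_) (((hw.add hr).mul_left (1 / 2)))
    have := two_mul_sqrt_le_dial (hμ K) (hS K) hvol
    simp only [one_div]
    linarith
  · intro h
    refine ⟨fun K => Real.sqrt (μ K * vol) + (1 / 2) ^ K, fun K => by positivity, ?_, ?_⟩
    · refine Summable.of_nonneg_of_le (fun K => div_nonneg (hμ K) (by positivity)) (fun K => ?_) h
      rcases (hμ K).eq_or_lt with hz | hpos
      · have h0 : μ K = 0 := hz.symm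
        simp [h0]
      · calc μ K / (Real.sqrt (μ K * vol) + (1 / 2) ^ K) ≤ μ K / Real.sqrt (μ K * vol) :=
            div_le_div_of_nonneg_left (hμ K) (Real.sqrt_pos.mpr (mul_pos hpos hvol)) (le_add_of_nonneg_right (by positivity))
          _ = Real.sqrt (μ K / vol) := (sqrtDial_eq hpos hvol).1
    · have h1 : Summable fun K => Real.sqrt (μ K * vol) / vol := by
        refine Summable.of_nonneg_of_le (fun K => by positivity) (fun K => ?_) h
        rcases (hμ K).eq_or_lt with hz | hpos
        · have h0 : μ K = 0 := hz.symm
          simp [h0]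
        · exact (sqrtDial_eq hpos hvol).2.le
      have hgeom : Summable fun K : ℕ => (1 / 2 : ℝ) ^ K / vol :=
        (summable_geometric_of_lt_one (by norm_num) (by norm_num)).div_const vol
      exact (h1.add hgeom).congr fun K => (add_div _ _ _).symm

end Dial

/-! ## §5 The loud-COUNT instance: flag by count, pay by the MEAN count [folklore] -/

section Count
variable {ι : Type*} [DecidableEq ι] {l₀ vol : ℝ} {T : ℕ → Finset ι}
  {A B mA mB sA sB cnt : ℕ → ℝ → ι → ℝ} {RA RB r base σl ν μ : ℕ → ℝ}

/-- **★★ FLAG BY COUNT, PAY BY THE MEAN COUNT** [folklore].  If each class's joint bill is at most a class-independent base plus its LOUD COUNT times a loud modulus,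
`s_A + s_B ≤ base_K + cnt·σl_K` (`cnt ≥ 0`, `σl_K ≥ 0`; g4's `modulus_le_of_loudCount`: `base = |B|·σq`), flag the classes with `ν_K < cnt` (`ν_K > 0`): on the kept classes the
bill is `≤ base_K + ν_K·σl_K`, and N20's face for the flagged ones follows from the MEAN-COUNT letters `Σ_τ cnt·A ≤ μ_K·Σ_τ A`, `Σ_τ cnt·B ≤ μ_K·Σ_τ B` by Markov (`W = μ∕ν`):
`HybridNE7 … {ν < cnt} (μ∕ν) 0 0 0 (r + (base + ν·σl)∕vol)`.  (A mean count is what LINEARITY over per-block absolute letters gives; no independence of the blocks is used.) -/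
theorem hybridNE7_countFlag_of_meanCount (hvol : 0 < vol)
    (hA : ∀ (K : ℕ) (t : ℝ), |t| ≤ l₀ → ∀ τ ∈ T K,
      Real.exp (-sA K t τ) * (mA K t τ * RA K) ≤ A K t τ ∧ A K t τ ≤ Real.exp (sA K t τ) * (mA K t τ * RA K))
    (hB : ∀ (K : ℕ) (t : ℝ), |t| ≤ l₀ → ∀ τ ∈ T K,
      Real.exp (-sB K t τ) * (mB K t τ * RB K) ≤ B K t τ ∧ B K t τ ≤ Real.exp (sB K t τ) * (mB K t τ * RB K))
    (hbill : ∀ (K : ℕ) (t : ℝ), |t| ≤ l₀ → ∀ τ ∈ T K, sA K t τ + sB K t τ ≤ base K + cnt K t τ * σl K)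
    (hmA : ∀ (K : ℕ) (t : ℝ), |t| ≤ l₀ → ∀ τ ∈ T K, 0 ≤ mA K t τ)
    (hRA : ∀ K, 0 < RA K) (hRB : ∀ K, 0 < RB K) (hm : Core l₀ vol T (fun _ _ => ∅) mA mB r)
    (hA0 : ∀ (K : ℕ) (t : ℝ), |t| ≤ l₀ → ∀ τ ∈ T K, 0 ≤ A K t τ) (hB0 : ∀ (K : ℕ) (t : ℝ), |t| ≤ l₀ → ∀ τ ∈ T K, 0 ≤ B K t τ)
    (hcnt : ∀ (K : ℕ) (t : ℝ), |t| ≤ l₀ → ∀ τ ∈ T K, 0 ≤ cnt K t τ) (hσl : ∀ K, 0 ≤ σl K)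
    (hμA : ∀ (K : ℕ) (t : ℝ), |t| ≤ l₀ → ∑ τ ∈ T K, cnt K t τ * A K t τ ≤ μ K * ∑ τ ∈ T K, A K t τ)
    (hμB : ∀ (K : ℕ) (t : ℝ), |t| ≤ l₀ → ∑ τ ∈ T K, cnt K t τ * B K t τ ≤ μ K * ∑ τ ∈ T K, B K t τ)
    (hν : ∀ K, 0 < ν K) (hμ0 : ∀ K, 0 ≤ μ K) (hlt : ∀ K, μ K / ν K < 1) (hμν : Summable fun K => μ K / ν K)
    (hrad : Summable fun K => r K + (base K + ν K * σl K) / vol) :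
    HybridNE7 l₀ vol T A B (fun K t => (T K).filter fun τ => ν K < cnt K t τ) (fun K => μ K / ν K)
      (fun _ _ _ => 0) (fun _ _ _ => 0) (fun _ => 0) (fun K => r K + (base K + ν K * σl K) / vol) := by
  have hW := relWeightBound_flag_of_meanLetters (φ := cnt) hA0 hB0 hcnt hμA hμB hν hμ0 hlt hμν
  have hsub : ∀ (K : ℕ) (t : ℝ), |t| ≤ l₀ → T K \ (T K).filter (fun τ => ν K < cnt K t τ) ⊆ T K \ ∅ :=
    fun K t _ => Finset.sdiff_subset_sdiff (Finset.Subset.refl _) (Finset.empty_subset _)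
  refine hybridNE7_noShell hW hA0 hB0 hrad
    (core_of_classFactorisation_jointBill hvol (fun K t ht τ hτ => hA K t ht τ (Finset.mem_sdiff.mp hτ).1)
      (fun K t ht τ hτ => hB K t ht τ (Finset.mem_sdiff.mp hτ).1) (fun K t ht τ hτ => ?_) (fun K t ht τ hτ => hmA K t ht τ (Finset.mem_sdiff.mp hτ).1)
      hRA hRB (core_of_subset le_rfl hsub hm))
  obtain ⟨hτ', hle⟩ := (mem_sdiff_flag_iff (φ := cnt)).mp hτ
  exact (hbill K t ht τ hτ').trans (by nlinarith [hσl K])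

/-- **★ THE BLOCKWISE BILL IS A COUNT BILL** [folklore] (g4 `modulus_le_of_loudCount` read with `N :=` the class's own loud count): block moduli `σ b ≤ σq` on the quiet blocks and
`≤ σl` on the loud ones (`0 ≤ σq ≤ σl`) ⇒ `Σ_{b ∈ B} σ b ≤ |B|·σq + |loud|·σl` — the hypothesis shape `hbill` of `hybridNE7_countFlag_of_meanCount` with `base := |B|·σq`,
`cnt := |loud|`. -/
theorem blockBill_le_base_add_count_mul {β : Type*} {Bl : Finset β} {σ : β → ℝ} {σq σL : ℝ} (loud : Finset β) (hloud : loud ⊆ Bl)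
    (hq : 0 ≤ σq) (hql : σq ≤ σL) (hquiet : ∀ b ∈ Bl, b ∉ loud → σ b ≤ σq) (hl : ∀ b ∈ loud, σ b ≤ σL) :
    ∑ b ∈ Bl, σ b ≤ Bl.card * σq + (loud.card : ℝ) * σL :=
  modulus_le_of_loudCount loud hloud hq hql hquiet hl le_rfl

end Count

end Summit.QuantumFields.YangMills.BalabanUVNodes.N19BillFlag
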